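import Summits.AtomisticToContinuum.HydrodynamicLimit.Theorems.JParityClosureLocalSecondLawLedgerKernel
import Summits.AtomisticToContinuum.HydrodynamicLimit.Theorems.JParityClosureLocalSecondLawLedgerCalculus
import Literature.Analysis.FluidPDE.CollisionalTransfer
import Mathlib.Analysis.Calculus.FDeriv.Measurable

/-!
# Entropy ledger for `JParityClosure.LocalSecondLaw` — the cone fields along lines and free flights
(stmt-AtomisticToContinuum-13081, line `exact-entropy-ledger-three-passivities`, layer 3 of stub L)

At a field point where all kernels `b_r(xᵢ, ·)` are differentiable (almost every point, layer 1), the linear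
moments `ρ_r, m_r, e_r, M_r, Q_r` of a configuration are differentiable along every line `t ↦ x₀ + t e` through
the field point and along the free flight `t ↦ (xᵢ + t vᵢ, vᵢ)ᵢ` of the configuration, and the SAME-KERNEL
identity turns the free-flight derivatives into minus divergences of the next moments:
`∂ₜρ_r = -div m_r`, `∂ₜm_r = -div M_r`, `∂ₜe_r = -div Q_r` (pointwise, at good field points).  For a
configuration in the regular range (`c ≤ ρ_r`, `ρ_rσ³ ≤ η₁`, `c ≤ θ_r` everywhere) all coarse fields are
Lipschitz on `𝕋³`; the crux's partial derivative `∂ₖ` of a Lipschitz field is measurable and bounded by the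
Lipschitz constant.

References: R. J. Hardy, J. Chem. Phys. 76 (1982) 622; J. H. Irving, J. G. Kirkwood, J. Chem. Phys. 18 (1950) 817.
-/

noncomputable section

namespace Summit.AtomisticToContinuum.HydrodynamicLimit.Theorems.LocalSecondLawLedger

open scoped BigOperators Topology ENNReal InnerProductSpace
open Filter Set MeasureTheory
open Literature.MathematicalPhysics.KineticTheory
open Literature.Analysis.FluidPDE
open Literature.Analysis.FunctionSpaces
open Summit.AtomisticToContinuum.HydrodynamicLimit.Theorems.LocalSecondLawNegative

namespace L

variable {N : ℕ}

/-! ## Directional derivatives of the kernel and of the linear moments -/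

/-- The directional derivative `∂_e b_r(y, ·)(x₀)` of the kernel in the field point (`-D b(y - x₀) e`). [folklore] -/
def cg (r : ℝ) (y x : T3) (e : V3) : ℝ :=
  -(Torus.fderiv (fun z : T3 => cone r z 0) (y - x) e)

/-- The directional derivative of the kernel is linear in the direction. [folklore] -/
theorem cg_eq_sum (r : ℝ) (y x : T3) (v : V3) :
    cg r y x v = ∑ k : Fin 3, v k * cg r y x (EuclideanSpace.single k 1) := by
  unfold cg
  rw [fderiv_cone_apply_eq_sum, ← Finset.sum_neg_distrib]
  simp [mul_neg]

/-- `|∂_e b| ≤ (3√3/(πr⁴)) ‖e‖`. [folklore] -/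
theorem abs_cg_le {r : ℝ} (hr : 0 < r) (y x : T3) (e : V3) : |cg r y x e| ≤ coneLip r * ‖e‖ := by
  unfold cg; rw [abs_neg]; exact abs_fderiv_cone_le hr _ _

/-- `|∂ₖ b| ≤ 3√3/(πr⁴)`. [folklore] -/
theorem abs_cg_single_le {r : ℝ} (hr : 0 < r) (y x : T3) (k : Fin 3) :
    |cg r y x (EuclideanSpace.single k 1)| ≤ coneLip r := by
  simpa using abs_cg_le hr y x (EuclideanSpace.single k 1)

/-- The directional derivative of the kernel is measurable in the field point. [folklore] -/
theorem measurable_cg (r : ℝ) (y : T3) (e : V3) : Measurable fun x => cg r y x e :=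
  (measurable_fderiv_cone_sub r y e).neg

/-- Directional derivative of the mollified density: `∂_e ρ_r = (N+1)⁻¹ ∑ᵢ ∂_e b(xᵢ, ·)`. [folklore] -/
def dRho (r : ℝ) (w : Phase N) (x : T3) (e : V3) : ℝ :=
  ((N + 1 : ℕ) : ℝ)⁻¹ * ∑ i, cg r (w i).1 x e

/-- Directional derivative of the mollified momentum. [folklore] -/
def dMom (r : ℝ) (w : Phase N) (x : T3) (e : V3) (l : Fin 3) : ℝ :=
  ((N + 1 : ℕ) : ℝ)⁻¹ * ∑ i, cg r (w i).1 x e * (w i).2 l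

/-- Directional derivative of the second velocity moment. [folklore] -/
def dMmom (r : ℝ) (w : Phase N) (x : T3) (e : V3) (k l : Fin 3) : ℝ :=
  ((N + 1 : ℕ) : ℝ)⁻¹ * ∑ i, cg r (w i).1 x e * ((w i).2 k * (w i).2 l)

/-- Directional derivative of the half third velocity moment. [folklore] -/
def dQmom (r : ℝ) (w : Phase N) (x : T3) (e : V3) (k : Fin 3) : ℝ :=
  ((N + 1 : ℕ) : ℝ)⁻¹ * ∑ i, cg r (w i).1 x e * (‖(w i).2‖ ^ 2 / 2 * (w i).2 k)

/-! ## Derivatives along lines through a good field point -/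

section Line

variable {r : ℝ} {w : Phase N} {x : T3}

/-- The kernel of particle `i` along a line through a good field point. [folklore] -/
theorem hasDerivAt_cone_line {i : Fin (N + 1)}
    (hx : DifferentiableAt ℝ (Torus.liftAt (fun z : T3 => cone r z 0) ((w i).1 - x)) 0) (e : V3) :
    HasDerivAt (fun t : ℝ => cone r (w i).1 (x + Torus.proj (t • e))) (cg r (w i).1 x e) 0 :=
  hasDerivAt_cone_field hx e

variable (hx : ∀ i, DifferentiableAt ℝ (Torus.liftAt (fun z : T3 => cone r z 0) ((w i).1 - x)) 0)
include hx

/-- The mollified density along a line through a good field point. [folklore] -/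
theorem hasDerivAt_rhoC_line (e : V3) :
    HasDerivAt (fun t : ℝ => rhoC r w (x + Torus.proj (t • e))) (dRho r w x e) 0 := by
  simp only [rhoC_eq_sum]
  exact (HasDerivAt.fun_sum fun i _ => hasDerivAt_cone_line (hx i) e).const_mul _

/-- The mollified momentum along a line through a good field point. [folklore] -/
theorem hasDerivAt_momC_line (e : V3) (l : Fin 3) :
    HasDerivAt (fun t : ℝ => momC r w (x + Torus.proj (t • e)) l) (dMom r w x e l) 0 := by
  simp only [momC_apply_eq_sum]
  exact (HasDerivAt.fun_sum fun i _ => (hasDerivAt_cone_line (hx i) e).mul_const _).const_mul _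

/-- The second moment along a line through a good field point. [folklore] -/
theorem hasDerivAt_Mmom_line (e : V3) (k l : Fin 3) :
    HasDerivAt (fun t : ℝ => Mmom r w (x + Torus.proj (t • e)) k l) (dMmom r w x e k l) 0 := by
  unfold Mmom
  exact (HasDerivAt.fun_sum fun i _ => (hasDerivAt_cone_line (hx i) e).mul_const _).const_mul _

/-- The half third moment along a line through a good field point. [folklore] -/
theorem hasDerivAt_Qmom_line (e : V3) (k : Fin 3) :
    HasDerivAt (fun t : ℝ => Qmom r w (x + Torus.proj (t • e)) k) (dQmom r w x e k) 0 := by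
  unfold Qmom
  exact (HasDerivAt.fun_sum fun i _ => (hasDerivAt_cone_line (hx i) e).mul_const _).const_mul _

/-- The mollified kinetic energy along a line through a good field point. [folklore] -/
theorem hasDerivAt_kinC_line (e : V3) :
    HasDerivAt (fun t : ℝ => kinC r w (x + Torus.proj (t • e))) ((∑ k : Fin 3, dMmom r w x e k k) / 2) 0 := by
  simp only [kinC_eq_trace]
  exact (HasDerivAt.fun_sum fun k _ => hasDerivAt_Mmom_line hx e k k).div_const 2

end Line

/-! ## Derivatives along the free flight: the same-kernel identity -/

section Flight

variable {r : ℝ} {w : Phase N} {x : T3}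

/-- Positions after free flight on the torus. [folklore] -/
@[simp] theorem freeFlight_torus_fst (t : ℝ) (w : Phase N) (i : Fin (N + 1)) :
    (freeFlight (Torus.geometry (Fin 3)) t w i).1 = (w i).1 + Torus.proj (t • (w i).2) := by
  simp [freeFlight_apply]

/-- Velocities are unchanged by free flight. [folklore] -/
@[simp] theorem freeFlight_torus_snd (t : ℝ) (w : Phase N) (i : Fin (N + 1)) :
    (freeFlight (Torus.geometry (Fin 3)) t w i).2 = (w i).2 := by
  simp [freeFlight_apply]

/-- The kernel of a freely moving particle read at a good field point. [folklore] -/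
theorem hasDerivAt_cone_flight' {i : Fin (N + 1)}
    (hx : DifferentiableAt ℝ (Torus.liftAt (fun z : T3 => cone r z 0) ((w i).1 - x)) 0) :
    HasDerivAt (fun t : ℝ => cone r ((w i).1 + Torus.proj (t • (w i).2)) x) (-cg r (w i).1 x (w i).2) 0 := by
  unfold cg; rw [neg_neg]; exact hasDerivAt_cone_flight hx (w i).2

/-- Re-indexing a particle sum of velocity-contracted kernel derivatives as a sum over directions. [folklore] -/
theorem sum_neg_cg_vel_mul (r : ℝ) (w : Phase N) (x : T3) (a : Fin (N + 1) → ℝ) :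
    ((N + 1 : ℕ) : ℝ)⁻¹ * ∑ i, -cg r (w i).1 x (w i).2 * a i =
      -∑ k : Fin 3, ((N + 1 : ℕ) : ℝ)⁻¹ * ∑ i, cg r (w i).1 x (EuclideanSpace.single k 1) * ((w i).2 k * a i) := by
  have h : ∀ i, -cg r (w i).1 x (w i).2 * a i =
      -∑ k : Fin 3, cg r (w i).1 x (EuclideanSpace.single k 1) * ((w i).2 k * a i) := fun i => by
    rw [cg_eq_sum, ← Finset.sum_neg_distrib, ← Finset.sum_neg_distrib, Finset.sum_mul]
    refine Finset.sum_congr rfl fun k _ => ?_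
    ring
  simp only [h, Finset.sum_neg_distrib, mul_neg, Finset.mul_sum]
  rw [Finset.sum_comm]

variable (hx : ∀ i, DifferentiableAt ℝ (Torus.liftAt (fun z : T3 => cone r z 0) ((w i).1 - x)) 0)
include hx

/-- **Same-kernel identity, mass**: `∂ₜ ρ_r = -∑ₖ ∂ₖ m_{r,k}` along the free flight, at a good field point.
[folklore] -/
theorem hasDerivAt_rhoC_flight :
    HasDerivAt (fun t : ℝ => rhoC r (freeFlight (Torus.geometry (Fin 3)) t w) x)
      (-∑ k : Fin 3, dMom r w x (EuclideanSpace.single k 1) k) 0 := by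
  simp only [rhoC_eq_sum, freeFlight_torus_fst]
  have h := (HasDerivAt.fun_sum (u := Finset.univ) fun i _ => hasDerivAt_cone_flight' (hx i)).const_mul
    (((N + 1 : ℕ) : ℝ)⁻¹)
  refine h.congr_deriv ?_
  have := sum_neg_cg_vel_mul r w x fun _ => 1
  simp only [mul_one] at this
  rw [this]
  rfl

/-- **Same-kernel identity, momentum**: `∂ₜ m_{r,l} = -∑ₖ ∂ₖ M_{r,kl}` along the free flight. [folklore] -/
theorem hasDerivAt_momC_flight (l : Fin 3) :
    HasDerivAt (fun t : ℝ => momC r (freeFlight (Torus.geometry (Fin 3)) t w) x l)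
      (-∑ k : Fin 3, dMmom r w x (EuclideanSpace.single k 1) k l) 0 := by
  simp only [momC_apply_eq_sum, freeFlight_torus_fst, freeFlight_torus_snd]
  have h := (HasDerivAt.fun_sum (u := Finset.univ) fun i _ =>
    (hasDerivAt_cone_flight' (hx i)).mul_const ((w i).2 l)).const_mul (((N + 1 : ℕ) : ℝ)⁻¹)
  refine h.congr_deriv ?_
  rw [sum_neg_cg_vel_mul r w x fun i => (w i).2 l]
  rfl

/-- **Same-kernel identity, energy**: `∂ₜ e_r = -∑ₖ ∂ₖ Q_{r,k}` along the free flight. [folklore] -/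
theorem hasDerivAt_kinC_flight :
    HasDerivAt (fun t : ℝ => kinC r (freeFlight (Torus.geometry (Fin 3)) t w) x)
      (-∑ k : Fin 3, dQmom r w x (EuclideanSpace.single k 1) k) 0 := by
  simp only [kinC_eq_sum, freeFlight_torus_fst, freeFlight_torus_snd]
  have h := (HasDerivAt.fun_sum (u := Finset.univ) fun i _ =>
    (hasDerivAt_cone_flight' (hx i)).mul_const (‖(w i).2‖ ^ 2 / 2)).const_mul (((N + 1 : ℕ) : ℝ)⁻¹)
  refine h.congr_deriv ?_
  rw [sum_neg_cg_vel_mul r w x fun i => ‖(w i).2‖ ^ 2 / 2]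
  unfold dQmom
  congr 1
  refine Finset.sum_congr rfl fun k _ => ?_
  congr 1
  refine Finset.sum_congr rfl fun i _ => ?_
  ring

end Flight

/-! ## Lipschitz continuity of the coarse fields -/

section LipschitzFields

variable {r : ℝ} (hr : 0 < r) (w : Phase N)
include hr

/-- A velocity-weighted particle sum of kernels is Lipschitz in the field point. [folklore] -/
theorem exists_lipschitzWith_cone_sum (a : Fin (N + 1) → ℝ) :
    ∃ K, LipschitzWith K fun x => ((N + 1 : ℕ) : ℝ)⁻¹ * ∑ i, cone r (w i).1 x * a i := by
  have h : ∀ i ∈ (Finset.univ : Finset (Fin (N + 1))),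
      LipschitzWith (Real.toNNReal |a i| * coneLip r) fun x => cone r (w i).1 x * a i := fun i _ => by
    simpa only [mul_comm (cone r _ _)] using lipschitzWith_const_mul' (lipschitzWith_cone_right hr (w i).1) (a i)
  exact ⟨_, lipschitzWith_const_mul' (lipschitzWith_finset_sum _ h) _⟩

/-- The mollified density is Lipschitz. [folklore] -/
theorem exists_lipschitzWith_rhoC : ∃ K, LipschitzWith K (rhoC r w) := by
  obtain ⟨K, hK⟩ := exists_lipschitzWith_cone_sum hr w fun _ => 1
  refine ⟨K, ?_⟩
  have : rhoC r w = fun x => ((N + 1 : ℕ) : ℝ)⁻¹ * ∑ i, cone r (w i).1 x * 1 :=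
    funext fun x => by rw [rhoC_eq_sum]; simp
  rwa [this]

/-- The components of the mollified momentum are Lipschitz. [folklore] -/
theorem exists_lipschitzWith_momC (l : Fin 3) : ∃ K, LipschitzWith K fun x => momC r w x l := by
  obtain ⟨K, hK⟩ := exists_lipschitzWith_cone_sum hr w fun i => (w i).2 l
  exact ⟨K, by simpa only [momC_apply_eq_sum] using hK⟩

/-- The mollified kinetic energy is Lipschitz. [folklore] -/
theorem exists_lipschitzWith_kinC : ∃ K, LipschitzWith K (kinC r w) := by
  obtain ⟨K, hK⟩ := exists_lipschitzWith_cone_sum hr w fun i => ‖(w i).2‖ ^ 2 / 2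
  refine ⟨K, ?_⟩
  have : kinC r w = fun x => ((N + 1 : ℕ) : ℝ)⁻¹ * ∑ i, cone r (w i).1 x * (‖(w i).2‖ ^ 2 / 2) :=
    funext fun x => kinC_eq_sum r w x
  rwa [this]

/-- The second moment is Lipschitz. [folklore] -/
theorem exists_lipschitzWith_Mmom (k l : Fin 3) : ∃ K, LipschitzWith K fun x => Mmom r w x k l :=
  exists_lipschitzWith_cone_sum hr w fun i => (w i).2 k * (w i).2 l

/-- The half third moment is Lipschitz. [folklore] -/
theorem exists_lipschitzWith_Qmom (k : Fin 3) : ∃ K, LipschitzWith K fun x => Qmom r w x k :=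
  exists_lipschitzWith_cone_sum hr w fun i => ‖(w i).2‖ ^ 2 / 2 * (w i).2 k

variable {σ c η₁ : ℝ} (hc : 0 < c)
  (hreg : ∀ x, c ≤ rhoC r w x ∧ rhoC r w x * σ ^ 3 ≤ η₁ ∧ c ≤ thetaC r w x)
include hc hreg

/-- In the regular range the inverse density is Lipschitz. [folklore] -/
theorem exists_lipschitzWith_inv_rhoC : ∃ K, LipschitzWith K fun x => (rhoC r w x)⁻¹ := by
  obtain ⟨K, hK⟩ := exists_lipschitzWith_rhoC hr w
  exact ⟨_, lipschitzWith_inv_of_ge hK hc fun x => (hreg x).1⟩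

/-- In the regular range the coarse velocity is Lipschitz. [folklore] -/
theorem exists_lipschitzWith_uC (l : Fin 3) : ∃ K, LipschitzWith K fun x => uC r w x l := by
  obtain ⟨K₁, h₁⟩ := exists_lipschitzWith_inv_rhoC hr w hc hreg
  obtain ⟨K₂, h₂⟩ := exists_lipschitzWith_momC hr w l
  obtain ⟨A, hA⟩ := exists_abs_le_of_lipschitzWith h₁
  obtain ⟨B, hB⟩ := exists_abs_le_of_lipschitzWith h₂
  have h := lipschitzWith_mul_bounded h₁ h₂ hA hB
  have hfun : (fun x => uC r w x l) = fun x => (rhoC r w x)⁻¹ * momC r w x l := funext fun x => uC_apply r w x l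
  rw [hfun]
  exact ⟨_, h⟩

/-- In the regular range the coarse temperature is Lipschitz. [folklore] -/
theorem exists_lipschitzWith_thetaC : ∃ K, LipschitzWith K (thetaC r w) := by
  obtain ⟨K₁, h₁⟩ := exists_lipschitzWith_inv_rhoC hr w hc hreg
  obtain ⟨K₂, h₂⟩ := exists_lipschitzWith_kinC hr w
  obtain ⟨A, hA⟩ := exists_abs_le_of_lipschitzWith h₁
  obtain ⟨B, hB⟩ := exists_abs_le_of_lipschitzWith h₂
  have hsq : ∀ l : Fin 3, ∃ K, LipschitzWith K fun x => momC r w x l * momC r w x l := fun l => by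
    obtain ⟨K₃, h₃⟩ := exists_lipschitzWith_momC hr w l
    obtain ⟨C, hC⟩ := exists_abs_le_of_lipschitzWith h₃
    exact ⟨_, lipschitzWith_mul_bounded h₃ h₃ hC hC⟩
  choose K₃ h₃ using hsq
  have hsum := lipschitzWith_finset_sum Finset.univ fun l _ => h₃ l
  obtain ⟨C, hC⟩ := exists_abs_le_of_lipschitzWith hsum
  have hii := lipschitzWith_mul_bounded h₁ h₁ hA hA
  obtain ⟨D, hD⟩ := exists_abs_le_of_lipschitzWith hii
  have hterm1 := lipschitzWith_mul_bounded h₂ h₁ hB hA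
  have hterm2 := lipschitzWith_mul_bounded hsum hii hC hD
  have htot := lipschitzWith_const_mul' (hterm1.sub (lipschitzWith_const_mul' hterm2 (1 / 2))) (2 / 3)
  have hfun : thetaC r w = fun x => 2 / 3 * (kinC r w x * (rhoC r w x)⁻¹ -
      1 / 2 * ((∑ i, momC r w x i * momC r w x i) * ((rhoC r w x)⁻¹ * (rhoC r w x)⁻¹))) := by
    funext x
    have hρ : rhoC r w x ≠ 0 := (hc.trans_le (hreg x).1).ne'
    rw [thetaC_eq]
    simp only [pow_two]
    field_simp
  rw [hfun]
  exact ⟨_, htot⟩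

/-- In the regular range the inverse coarse temperature is Lipschitz. [folklore] -/
theorem exists_lipschitzWith_inv_thetaC : ∃ K, LipschitzWith K fun x => (thetaC r w x)⁻¹ := by
  obtain ⟨K, hK⟩ := exists_lipschitzWith_thetaC hr w hc hreg
  exact ⟨_, lipschitzWith_inv_of_ge hK hc fun x => (hreg x).2.2⟩

/-- In the regular range the kinetic heat current is Lipschitz. [folklore] -/
theorem exists_lipschitzWith_qkinC (k : Fin 3) : ∃ K, LipschitzWith K fun x => qkinC r w x k := by
  have hu := fun l => exists_lipschitzWith_uC hr w hc hreg l
  choose Ku hKu using hu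
  have hbu := fun l => exists_abs_le_of_lipschitzWith (hKu l)
  choose Bu hBu using hbu
  -- each particle term `b_i (‖v_i - u‖²/2)(v_ik - u_k)` is a product of bounded Lipschitz functions
  have hterm : ∀ i : Fin (N + 1), ∃ K, LipschitzWith K fun x =>
      cone r (w i).1 x * (‖(w i).2 - uC r w x‖ ^ 2 / 2 * ((w i).2 k - uC r w x k)) := by
    intro i
    have hdiff : ∀ l : Fin 3, LipschitzWith (Ku l) fun x => (w i).2 l - uC r w x l := fun l =>
      by simpa using (LipschitzWith.const ((w i).2 l)).sub (hKu l)
    have hbdiff : ∀ l x, |(w i).2 l - uC r w x l| ≤ |(w i).2 l| + Bu l := fun l x =>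
      (abs_sub _ _).trans (by linarith [hBu l x])
    have hsq : ∀ l : Fin 3, LipschitzWith _ fun x => ((w i).2 l - uC r w x l) * ((w i).2 l - uC r w x l) :=
      fun l => lipschitzWith_mul_bounded (hdiff l) (hdiff l) (hbdiff l) (hbdiff l)
    have hn := lipschitzWith_const_mul' (lipschitzWith_finset_sum Finset.univ fun l _ => hsq l) (1 / 2)
    obtain ⟨C, hC⟩ := exists_abs_le_of_lipschitzWith hn
    have hprod := lipschitzWith_mul_bounded hn (hdiff k) hC (hbdiff k)
    obtain ⟨D, hD⟩ := exists_abs_le_of_lipschitzWith hprod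
    have hfin := lipschitzWith_mul_bounded (lipschitzWith_cone_right hr (w i).1) hprod (abs_cone_le hr (w i).1) hD
    have hfun : (fun x => cone r (w i).1 x * (‖(w i).2 - uC r w x‖ ^ 2 / 2 * ((w i).2 k - uC r w x k))) =
        fun x => cone r (w i).1 x * (1 / 2 * (∑ l, ((w i).2 l - uC r w x l) * ((w i).2 l - uC r w x l))
          * ((w i).2 k - uC r w x k)) := by
      funext x
      rw [norm_sq_eq_sum]
      simp only [PiLp.sub_apply, pow_two]
      ring
    rw [hfun]
    exact ⟨_, hfin⟩
  choose K hK using hterm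
  have hs := lipschitzWith_const_mul' (lipschitzWith_finset_sum Finset.univ fun i _ => hK i) (((N + 1 : ℕ) : ℝ)⁻¹)
  have hfun : (fun x => qkinC r w x k) = fun x => ((N + 1 : ℕ) : ℝ)⁻¹ *
      ∑ i, cone r (w i).1 x * (‖(w i).2 - uC r w x‖ ^ 2 / 2 * ((w i).2 k - uC r w x k)) := by
    funext x
    unfold qkinC
    rw [integral_empiricalMeasure_vec]
    rw [PiLp.smul_apply, smul_eq_mul, WithLp.ofLp_sum, Finset.sum_apply]
    congr 1
    refine Finset.sum_congr rfl fun i _ => ?_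
    rw [WithLp.ofLp_smul, Pi.smul_apply, smul_eq_mul, PiLp.sub_apply, mul_assoc]
  rw [hfun]
  exact ⟨_, hs⟩

variable {η₀ : ℝ} {F : ℝ → ℝ} (hE : EosBand η₀ F) (hη₁ : η₁ < η₀) (hσ : 0 < σ)
include hE hη₁ hσ

/-- In the regular range the entropy density `x ↦ H(ρ_r(x), θ_r(x))` is Lipschitz. [folklore] -/
theorem exists_lipschitzWith_Hs : ∃ K, LipschitzWith K fun x => Hs σ (rhoC r w x) (thetaC r w x) := by
  obtain ⟨Kρ, hρ⟩ := exists_lipschitzWith_rhoC hr w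
  obtain ⟨Kθ, hθ⟩ := exists_lipschitzWith_thetaC hr w hc hreg
  have hlogθ := lipschitzWith_comp_of_lipschitzOnWith (lipschitzOnWith_log_Ici hc) hθ fun x => (hreg x).2.2
  have hlogρ := lipschitzWith_comp_of_lipschitzOnWith (lipschitzOnWith_log_Ici hc) hρ fun x => (hreg x).1
  have hcσ : 0 < c * σ ^ 3 := by positivity
  obtain ⟨Kf, hf⟩ := eos_exists_lipschitzOnWith hE hcσ hη₁
  have hρσ : LipschitzWith (Kρ * Real.toNNReal |σ ^ 3|) fun x => rhoC r w x * σ ^ 3 := by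
    simpa only [mul_comm (rhoC r w _), mul_comm Kρ] using lipschitzWith_const_mul' hρ (σ ^ 3)
  have hfex := lipschitzWith_comp_of_lipschitzOnWith hf hρσ fun x =>
    ⟨mul_le_mul_of_nonneg_right (hreg x).1 (by positivity), (hreg x).2.1⟩
  have hinner := ((lipschitzWith_const_mul' hlogθ (3 / 2)).sub hlogρ).sub hfex
  obtain ⟨A, hA⟩ := exists_abs_le_of_lipschitzWith hρ
  obtain ⟨B, hB⟩ := exists_abs_le_of_lipschitzWith hinner
  have htot := (lipschitzWith_mul_bounded hρ hinner hA hB).neg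
  have hfun : (fun x => Hs σ (rhoC r w x) (thetaC r w x)) = -fun x => rhoC r w x *
      (3 / 2 * Real.log (thetaC r w x) - Real.log (rhoC r w x) - hsExcessFreeEnergy (rhoC r w x * σ ^ 3)) := by
    funext x
    rw [Hs_eq_Hsm (hc.trans_le (hreg x).1) (hc.trans_le (hreg x).2.2)]
    rfl
  rw [hfun]
  exact ⟨_, htot⟩

end LipschitzFields

end L

/-- **Registered sub-goal `ledgerL_fields`** of stub `stub_ledger` (line `exact-entropy-ledger-three-passivities`):
The cone fields are Lipschitz on the torus. [folklore] -/
theorem ledgerL_fields :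
  ∀ {N : ℕ} {r : ℝ}, 0 < r → ∀ (w : Phase N) (l : Fin 3), ∃ K, LipschitzWith K fun x => momC r w x l :=
  fun hr w l => L.exists_lipschitzWith_momC hr w l

end Summit.AtomisticToContinuum.HydrodynamicLimit.Theorems.LocalSecondLawLedger

end
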